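import Mathlib
import Summits.NavierStokesRegularity.NavierStokesRegularity.Theorems.FilamentSkeletonRssStadiumPlateauPiece
import Summits.NavierStokesRegularity.NavierStokesRegularity.Theorems.FilamentSkeletonRssStadiumConnectorPiece
import Summits.NavierStokesRegularity.NavierStokesRegularity.Theorems.FilamentSkeletonRssStadiumClampIntegral
import Summits.NavierStokesRegularity.NavierStokesRegularity.Theorems.FilamentSkeletonRssStadiumConstants

/-!
# The FROZEN contour pieces are differentiable at the target, in the concrete retype geometry (`TangentSkeletonNearStraightL`,
# stmt-NavierStokesRegularity-23320, registered stub `stub_stripPropagation` — the `hdiff` half of blueprint item R4′ of `DIAG-addendum2-landed-g2.md`)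

Concrete geometry (`16h ≤ hs`, `S₁₆ = {|Im| < h, |Re − c| < L + h}`, plateau `[c−P, c+P]`, `P = L + 8h`, connectors at `c ± P`, disc ratio 8, `M = 2`,
`0 ≤ Rb ≤ 1/2`): for `z₀ ∈ S₁₆` the frozen deformed part
  `Φ(Im z₀, z) = ∫_{c−P}^{c+P} K(z, σ+i·Im z₀) dσ − i•∫_0^{Im z₀} K(z, c+P+is) ds + i•∫_0^{Im z₀} K(z, c−P+is) ds`
is complex-differentiable at `z = z₀` (`frozen_differentiableAt`).  The radii are chosen inside the proof (`r₀ = √(κΛ⁻¹/48)/2`, `δ = min(dist(z₀, ∂S₁₆),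
ρ₀/7)`), the numerics come from Theorems.StadiumConstants, the pieces from Theorems.StadiumPlateauPiece / StadiumConnectorPiece rewritten through
Theorems.StadiumClampIntegral.  Together with Theorems.StadiumContourFreeze (`hfreeze`) and Theorems.StadiumOwnFarPiece this is everything
Theorems.StadiumContourFamily.differentiableOn_of_height_family needs for the own-filament continued field (blueprint R4′, final ~60 lines left).
HONEST FRAMING: bookkeeping for a HYPOTHETICAL filament skeleton on the NEGATIVE side of a MODEL route; nothing here bears on Navier–Stokes regularity or
blow-up.  `--supports stmt-NavierStokesRegularity-23320`.
-/

set_option linter.dupNamespace false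

noncomputable section

namespace Summit.NavierStokesRegularity.NavierStokesRegularity.Theorems.StadiumFrozenPieces

open Set Metric MeasureTheory Complex
open scoped InnerProductSpace Matrix
open Summit.NavierStokesRegularity.NavierStokesRegularity.Theorems.StadiumPlateauPiece
open Summit.NavierStokesRegularity.NavierStokesRegularity.Theorems.StadiumConnectorPiece
open Summit.NavierStokesRegularity.NavierStokesRegularity.Theorems.StadiumClampIntegral
open Summit.NavierStokesRegularity.NavierStokesRegularity.Theorems.StadiumConstants

/-- **The frozen pieces are differentiable at the target.**  See the module docstring. [folklore] -/
theorem frozen_differentiableAt {hs L cc Rb h κ Λ : ℝ} {F : ℂ → (Fin 3 → ℂ)} {G : ℂ → ℂ}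
    (hF : DifferentiableOn ℂ F {z : ℂ | |z.im| < hs ∧ |z.re - cc| < L + hs})
    (hunit : ∀ w ∈ {z : ℂ | |z.im| < hs ∧ |z.re - cc| < L + hs}, ∑ i, (deriv F w i) ^ 2 = 1)
    (hM : ∀ z ∈ {z : ℂ | |z.im| < hs ∧ |z.re - cc| < L + hs}, ‖deriv F z‖ ≤ 2)
    {X : ℝ → EuclideanSpace ℝ (Fin 3)} (hX : Differentiable ℝ X) (hXu : ∀ τ, ‖deriv X τ‖ = 1)
    (hRb0 : 0 ≤ Rb) (hRb : Rb ≤ 1 / 2) (hosc : ∀ τ σ, ‖deriv X τ - deriv X σ‖ ≤ Rb)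
    (hFX : ∀ r : ℝ, (r : ℂ) ∈ {z : ℂ | |z.im| < hs ∧ |z.re - cc| < L + hs} →
      F r = fun i => ((⟪X r, EuclideanSpace.single i (1:ℝ)⟫_ℝ : ℝ) : ℂ))
    (hG : DifferentiableOn ℂ G {z : ℂ | |z.im| < hs ∧ |z.re - cc| < L + hs})
    (hGre : ∀ w ∈ {z : ℂ | |z.im| < hs ∧ |z.re - cc| < L + hs}, Λ⁻¹ / 2 ≤ (G w).re)
    (hκ : 0 < κ) (hΛ : 0 < Λ) (hh : 0 < h) (h16 : 16 * h ≤ hs) (hL : 0 ≤ L)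
    {z₀ : ℂ} (hz₀ : |z₀.im| < h ∧ |z₀.re - cc| < L + h) :
    let K : ℂ → ℂ → (Fin 3 → ℂ) := fun z ζ => (((∑ i, (F z i - F ζ i) ^ 2) + (κ : ℂ) * G ζ) ^ ((3:ℂ) / 2))⁻¹ •
        (deriv F ζ ⨯₃ (fun i => F z i - F ζ i))
    DifferentiableAt ℂ (fun z =>
      (∫ σ in (cc - (L + 8 * h))..(cc + (L + 8 * h)), K z ((σ : ℂ) + (z₀.im : ℂ) * I)) -
        I • (∫ s in (0:ℝ)..z₀.im, K z (((cc + (L + 8 * h) : ℝ) : ℂ) + (s : ℂ) * I)) +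
        I • (∫ s in (0:ℝ)..z₀.im, K z (((cc - (L + 8 * h) : ℝ) : ℂ) + (s : ℂ) * I))) z₀ := by
  intro K
  set P : ℝ := L + 8 * h with hP
  have hPpos : 0 < P := by rw [hP]; linarith
  -- radii
  set ρ : ℝ := Real.sqrt (κ * Λ⁻¹ / 48) with hρ
  have hρpos : 0 < ρ := Real.sqrt_pos.2 (by positivity)
  have hρ2 : ρ ^ 2 = κ * Λ⁻¹ / 48 := Real.sq_sqrt (by positivity)
  set r₀ : ℝ := ρ / 2 with hr₀
  have hr₀pos : 0 < r₀ := by positivity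
  set δ : ℝ := min (min (h - |z₀.im|) (L + h - |z₀.re - cc|)) (ρ / 7) with hδ
  have hδpos : 0 < δ := lt_min (lt_min (by linarith [hz₀.1]) (by linarith [hz₀.2])) (by positivity)
  have hδ1 : δ ≤ h - |z₀.im| := (min_le_left _ _).trans (min_le_left _ _)
  have hδ2 : δ ≤ L + h - |z₀.re - cc| := (min_le_left _ _).trans (min_le_right _ _)
  have hδ3 : δ ≤ ρ / 7 := min_le_right _ _
  have hδm : δ ≤ 2 / 7 * r₀ := by rw [hr₀]; linarith
  have hsmall : 3 * (2:ℝ) ^ 2 * (r₀ + δ) ^ 2 ≤ κ * Λ⁻¹ / 4 := by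
    have h1 : r₀ + δ ≤ 9 / 14 * ρ := by rw [hr₀]; linarith
    have h2 : (r₀ + δ) ^ 2 ≤ (9 / 14 * ρ) ^ 2 := pow_le_pow_left₀ (by positivity) h1 2
    nlinarith [hρ2]
  -- the ball of targets lies in `S₁₆`
  have hball : ∀ z ∈ ball z₀ δ, |z.im| < h ∧ |z.re - cc| < L + h := by
    intro z hz
    rw [mem_ball, dist_eq_norm] at hz
    have him : |z.im - z₀.im| < δ := lt_of_le_of_lt (by simpa using Complex.abs_im_le_norm (z - z₀)) hz
    have hre : |z.re - z₀.re| < δ := lt_of_le_of_lt (by simpa using Complex.abs_re_le_norm (z - z₀)) hz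
    constructor
    · have := abs_add_le (z.im - z₀.im) z₀.im
      rw [show z.im - z₀.im + z₀.im = z.im by ring] at this
      linarith
    · have := abs_add_le (z.re - z₀.re) (z₀.re - cc)
      rw [show z.re - z₀.re + (z₀.re - cc) = z.re - cc by ring] at this
      linarith
  have hballS : ball z₀ δ ⊆ {z : ℂ | |z.im| < hs ∧ |z.re - cc| < L + hs} := fun z hz =>
    ⟨by linarith [(hball z hz).1], by linarith [(hball z hz).2]⟩
  have hballfit : ∀ z ∈ ball z₀ δ, 8 * |z.im| < hs ∧ |z.re - cc| + 8 * |z.im| < L + hs := fun z hz =>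
    ⟨by linarith [(hball z hz).1], by linarith [(hball z hz).1, (hball z hz).2]⟩
  -- numerics
  have hA := ratio8_hA hRb0 hRb
  have hC := ratio8_hC hRb0 hRb (by norm_num : (0:ℝ) ≤ 2 / 7) le_rfl
  -- (1) the plateau piece
  have hab : cc - P ≤ cc + P := by linarith
  have hplS : ∀ t ∈ Icc (cc - P) (cc + P), ((t : ℂ) + ((z₀.im : ℝ) : ℂ) * Complex.I) ∈ {z : ℂ | |z.im| < hs ∧ |z.re - cc| < L + hs} := by
    intro t ht
    refine ⟨by simpa using (by linarith [hz₀.1] : |z₀.im| < hs), ?_⟩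
    have : |t - cc| ≤ P := abs_le.2 ⟨by linarith [ht.1], by linarith [ht.2]⟩
    simpa using (by linarith : |t - cc| < L + hs)
  have hplfit : 8 * |z₀.im| < hs := by linarith [hz₀.1]
  have hplfit' : ∀ t ∈ Icc (cc - P) (cc + P), |t - cc| + 8 * |z₀.im| < L + hs := by
    intro t ht
    have : |t - cc| ≤ P := abs_le.2 ⟨by linarith [ht.1], by linarith [ht.2]⟩
    linarith [hz₀.1]
  have hPl := plateauPiece_differentiableOn (n := 8) (M := 2) (m := 2 / 7) hF hunit hM hX hXu hosc hFX hG hGre (by norm_num) hκ hΛ hab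
    hplS hplfit hplfit' hballS hballfit (by norm_num) (by norm_num) hr₀pos hδm hsmall hA hC
  have hPl' : DifferentiableOn ℂ (fun z => ∫ σ in (cc - P)..(cc + P), K z ((σ : ℂ) + (z₀.im : ℂ) * I)) (ball z₀ δ) := by
    refine hPl.congr fun z _ => ?_
    exact (setIntegral_clamp_eq_intervalIntegral (fun σ => K z ((σ : ℂ) + (z₀.im : ℂ) * I)) hab).symm
  -- (2) the connector pieces
  have hconn : ∀ x₀ : ℝ, |x₀ - cc| = P →
      DifferentiableOn ℂ (fun z => ∫ s in (0:ℝ)..z₀.im, K z ((x₀ : ℂ) + (s : ℂ) * I)) (ball z₀ δ) := by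
    intro x₀ hx₀
    have hfarz : ∀ z ∈ ball z₀ δ, 7 * h ≤ |z.re - x₀| := by
      intro z hz
      have := abs_sub_abs_le_abs_sub (x₀ - cc) (z.re - cc)
      rw [hx₀, show x₀ - cc - (z.re - cc) = -(z.re - x₀) by ring, abs_neg] at this
      linarith [(hball z hz).2]
    -- ordered endpoints
    rcases le_total 0 z₀.im with hy | hy
    · have hcoS : ∀ t ∈ Icc 0 z₀.im, ((x₀ : ℂ) + (t : ℂ) * Complex.I) ∈ {z : ℂ | |z.im| < hs ∧ |z.re - cc| < L + hs} := by
        intro t ht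
        refine ⟨?_, ?_⟩
        · have : |t| ≤ |z₀.im| := by rw [abs_of_nonneg ht.1, abs_of_nonneg hy]; exact ht.2
          simpa using (by linarith [hz₀.1] : |t| < hs)
        · simpa [hx₀] using (by linarith : P < L + hs)
      have hcofit : ∀ t ∈ Icc 0 z₀.im, 8 * |t| < hs ∧ |x₀ - cc| + 8 * |t| < L + hs := by
        intro t ht
        have : |t| ≤ |z₀.im| := by rw [abs_of_nonneg ht.1, abs_of_nonneg hy]; exact ht.2
        exact ⟨by linarith [hz₀.1], by rw [hx₀]; linarith [hz₀.1]⟩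
      have hheights : ∀ z ∈ ball z₀ δ, ∀ t ∈ Icc 0 z₀.im, |z.im - t| ≤ 2 / 7 * (7 * h) := by
        intro z hz t ht
        have h1 : |t| ≤ |z₀.im| := by rw [abs_of_nonneg ht.1, abs_of_nonneg hy]; exact ht.2
        have := abs_sub (z.im) t
        linarith [(hball z hz).1, hz₀.1]
      have hCo := connectorPiece_differentiableOn (n := 8) (M := 2) (m := 2 / 7) (r₀ := 7 * h) hF hunit hM hX hXu hosc hFX hG hGre
        (by norm_num) hκ hΛ hy hcoS hcofit hballS hballfit (by norm_num) (by norm_num) (by positivity) hfarz hheights hA hC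
      refine hCo.congr fun z _ => ?_
      exact (setIntegral_clamp_eq_intervalIntegral (fun s => K z ((x₀ : ℂ) + (s : ℂ) * I)) hy).symm
    · have hcoS : ∀ t ∈ Icc z₀.im 0, ((x₀ : ℂ) + (t : ℂ) * Complex.I) ∈ {z : ℂ | |z.im| < hs ∧ |z.re - cc| < L + hs} := by
        intro t ht
        refine ⟨?_, ?_⟩
        · have : |t| ≤ |z₀.im| := by rw [abs_of_nonpos ht.2, abs_of_nonpos hy]; linarith [ht.1]
          simpa using (by linarith [hz₀.1] : |t| < hs)
        · simpa [hx₀] using (by linarith : P < L + hs)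
      have hcofit : ∀ t ∈ Icc z₀.im 0, 8 * |t| < hs ∧ |x₀ - cc| + 8 * |t| < L + hs := by
        intro t ht
        have : |t| ≤ |z₀.im| := by rw [abs_of_nonpos ht.2, abs_of_nonpos hy]; linarith [ht.1]
        exact ⟨by linarith [hz₀.1], by rw [hx₀]; linarith [hz₀.1]⟩
      have hheights : ∀ z ∈ ball z₀ δ, ∀ t ∈ Icc z₀.im 0, |z.im - t| ≤ 2 / 7 * (7 * h) := by
        intro z hz t ht
        have h1 : |t| ≤ |z₀.im| := by rw [abs_of_nonpos ht.2, abs_of_nonpos hy]; linarith [ht.1]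
        have := abs_sub (z.im) t
        linarith [(hball z hz).1, hz₀.1]
      have hCo := connectorPiece_differentiableOn (n := 8) (M := 2) (m := 2 / 7) (r₀ := 7 * h) hF hunit hM hX hXu hosc hFX hG hGre
        (by norm_num) hκ hΛ hy hcoS hcofit hballS hballfit (by norm_num) (by norm_num) (by positivity) hfarz hheights hA hC
      refine (hCo.neg).congr fun z _ => ?_
      exact intervalIntegral_eq_neg_setIntegral_clamp (fun s => K z ((x₀ : ℂ) + (s : ℂ) * I)) hy
  have hPa : |cc - P - cc| = P := by rw [show cc - P - cc = -P by ring, abs_neg, abs_of_pos hPpos]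
  have hPb : |cc + P - cc| = P := by rw [show cc + P - cc = P by ring, abs_of_pos hPpos]
  have hCR := hconn (cc + P) hPb
  have hCL := hconn (cc - P) hPa
  have hnhds : ball z₀ δ ∈ nhds z₀ := Metric.ball_mem_nhds z₀ hδpos
  have h1 := hPl'.differentiableAt hnhds
  have h2 := hCR.differentiableAt hnhds
  have h3 := hCL.differentiableAt hnhds
  have e1 : (((cc + P : ℝ)) : ℂ) = ((cc + (L + 8 * h) : ℝ) : ℂ) := by rw [hP]
  exact ((h1.sub (h2.const_smul I)).add (h3.const_smul I))

end Summit.NavierStokesRegularity.NavierStokesRegularity.Theorems.StadiumFrozenPieces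

end
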